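/-
Copyright (c) 2026 the pub-hodgecm-mathlib formalisation cell (harness21).  Prover seat hodgecm-mathlib-K2E1-p14 (g2) (R90-TF S8 «U(Φ₃) χ-TWIN», TWIN-DAG row 7b-2 (E),
R90-CS-plan (g2) S8-R19), Track B «K2-LIT» ENGINE E1, h413 = `stmt-HodgeConjecture-24833`, route `HCCMUnconditional`: the (χ,τ) ball data at a general level on
`U(2,1)_{L∕L⁺}` — the N = 3 twin of ★ `K2E1ChiConvDataLevelCMTwo`.
-/
import Summits.HodgeConjecture.HodgeConjecture.Theorems.K2E1ChiConvDataCMThree                    -- ★ row 1 (K2E1-p16): `exists_chi_convData_cm_three` (hypothesis-first over `V`, letters `hfam`∕`hnc`)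
import Summits.HodgeConjecture.HodgeConjecture.Theorems.K2E1ArchSymbolCirclePhaseU3                -- ★ p861997 row 7b-1 (K2E1-p16): `hfam_gauge_cm_three`, `hnc_gauge_cm_three` at `V := chiSectionSpace χ K′ ω`
import Summits.HodgeConjecture.HodgeConjecture.Theorems.K2E1ChiSymbolWeylSymmetrySelfDualCMThree  -- ★ (C) FILE 2 (this seat): `chi_symbol_hsymm_of_selfDual_cm_three_of_mem` (`ŝ(1 − it) = ŝ(1 + it)`, self-dual χ)
import Summits.HodgeConjecture.HodgeConjecture.Theorems.K2E1AnalyticLevelSetNullU                  -- ★ (K2E4-p23): `frequently_line_nhdsWithin` (every rank)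
import HarnessLib

/-!
# S8 «U(Φ₃) χ-TWIN» row 7b-2 — `K2E1ChiConvDataLevelCMThree`: THE (χ,τ) BALL DATA AT A GENERAL LEVEL ON `U(2,1)_{L∕L⁺}` — ★ row 1 `exists_chi_convData_cm_three` AT
# `V := chiSectionSpace χ K′ ω` WITH ITS LETTERS `hfam`∕`hnc` DISCHARGED by the archimedean gauge family (★ row 7b-1 `K2E1ArchSymbolCirclePhaseU3`), and the SELF-DUAL edition
# with the eigenvalue symmetry `ŝ_i(2 − z) = ŝ_i(z)` (★ (C) `K2E1ChiSymbolWeylSymmetrySelfDualCMThree`) — the N = 3 twin of ★ `K2E1ChiConvDataLevelCMTwo`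

Cell `pub/hodgecm-mathlib`, crux H413 = `stmt-HodgeConjecture-24833`; R90-TF slab S8 (TWIN-DAG v1 of K2E1-p16 (g2), row 7b-2 (E), dealt S8-R19).  THEOREMS ONLY (no `def`, no `instance`, no
notation, no named-fact hypothesis, no `sorry`; default heartbeats); lane `--supports stmt-HodgeConjecture-24833 --as helper` (count-neutral).  Closes no socket.  CM pair `L∕L⁺`, `N = 3`;
general level `K′`; single-character currency `V(χ, K′, ω) = chiSectionSpace χ K′ ω` (rank-generic ★ `K2E1ChiSectionSpaceU2Defs`; `χ₂ = 1` in the pair dictionary of ★ D-S8-3).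
MECHANICAL TWIN: every token of ★ `K2E1ChiConvDataLevelCMTwo` under `(IsCMField.complexConj L) 2 ↦ 3`, `GL (Fin 2) ↦ GL (Fin 3)`, `IsTestFunctionGL 2 ↦ 3`, `StdForm.antidiagonal 2 ↦ 3`,
`standardMaximalCompactGL 2 ↦ 3`, Sobolev `n + 3 ↦ n + 4`, `iotaBound_cm ↦ iotaBound_cm_three`; the conclusion of HEAD 1 is ★ row 1's conclusion BYTE FOR BYTE with `V` instantiated; the
self-dual edition's symmetry is `2 − z` (centre `z = 1`), its letter `hMne` lives on the `U(2,1)` Godement half-plane `Re w₁ > 2`.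

THE MATHEMATICS ([BernsteinLapid2019, §4 Claim 1]; [Bump1997, proof of Lemma 2.3.2]; [MoeglinWaldspurger1995, IV.1.10]).  One call of ★ `exists_chi_convData_cm_three` with
`V := chiSectionSpace χ K′ ω` and the letters supplied by ★ `hfam_gauge_cm_three` ∕ ★ `hnc_gauge_cm_three`; then, for self-dual `χ`, the axis identity `ŝ_i(1 − it) = ŝ_i(1 + it)` (★ (C)
`chi_symbol_hsymm_of_selfDual_cm_three_of_mem`, whose `hR` is the package's action clause) and the identity principle for the entire `ŝ_i`, `ŝ_i ∘ (2 − ·)` along `Re z = 1`.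
* HEAD **`exists_chi_convData_level_cm_three`** — structural binders as at N = 2: `K′ ≤ K`, `ι(K_∞) ⊆ K′`, `U₀ ≤ GL₃(𝔸_L^∞)` open compact with `ι_f(U₀ ∩ G_f) ⊆ K′` and `ω = 1` there,
  continuity of the sections, auxiliary Haar measures `μ_∞` (two-sided) on `G_∞`, `μ_f` on `G(𝔸_f)` (proof-only).
* HEAD **`exists_chi_convData_level_cm_three_symm`** — the same ∃-package with the extra conjunct `∀ i z, ŝ i (2 − z) = ŝ i z` (self-dual `χ`, radical package `(ν, 𝓕)`, one measurable
  bounded `φ₀ ∈ V` with `hMne` at `Re w₁ > 2`).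
HONEST LABEL: HC_CM is proved only modulo the 7 printed citations (2 remaining named inputs: hLiu418 = `stmt-HodgeConjecture-24832`, h413 = `stmt-HodgeConjecture-24833`) until rung 0
closes; count-neutral helper, closes no socket; the self-dual edition is conditional by construction on the visible letter `hMne`.

## References
* [BernsteinLapid2019] J. Bernstein, E. Lapid, *On the meromorphic continuation of Eisenstein series*, J. AMS 37 (2024), §4 Claim 1.  * [Bump1997] D. Bump, *Automorphic Forms and
  Representations* (1997), proof of Lemma 2.3.2.  * [MoeglinWaldspurger1995] C. Mœglin, J.-L. Waldspurger, *Spectral decomposition and Eisenstein series* (1995), IV.1.10.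
-/

set_option autoImplicit false
set_option linter.dupNamespace false  -- the mandated namespace repeats the summit's segment (`HodgeConjecture.HodgeConjecture`)

noncomputable section

open MeasureTheory Measure Filter Topology Set NumberField IsDedekindDomain
open scoped NNReal ENNReal ComplexConjugate MatrixGroups
open Literature.MeasureTheory.Group Literature.NumberTheory Literature.NumberTheory.Automorphic Literature.NumberTheory.Automorphic.UnitaryGroup AdelicGroupData
open Literature.NumberTheory.GaloisRepresentations (HeckeCharacter)
open Summit.HodgeConjecture.HodgeConjecture.Cruxes.H413.K2E1BorelEisensteinU
open Summit.HodgeConjecture.HodgeConjecture.Cruxes.H413.K2E1BLBorelSpacesU2Defs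
open Summit.HodgeConjecture.HodgeConjecture.Cruxes.H413.K2E1BLBorelOperatorsU2Defs
open Summit.HodgeConjecture.HodgeConjecture.Cruxes.H413.K2E1BLIotaClosedEmbeddingU3 (iotaBound_cm_three)
open Summit.HodgeConjecture.HodgeConjecture.Cruxes.H413.K2E1CharacterEisensteinU2Defs
open Summit.HodgeConjecture.HodgeConjecture.Cruxes.H413.K2E1ChiSectionSpaceU2Defs
open Summit.HodgeConjecture.HodgeConjecture.Cruxes.H413.K2E1ChiConvDataCMThree (exists_chi_convData_cm_three)
open Summit.HodgeConjecture.HodgeConjecture.Cruxes.H413.K2E1ArchSymbolCirclePhaseU3 (hfam_gauge_cm_three hnc_gauge_cm_three)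
open Summit.HodgeConjecture.HodgeConjecture.Cruxes.H413.K2E1ChiSymbolWeylSymmetrySelfDualCMThree (chi_symbol_hsymm_of_selfDual_cm_three_of_mem)
open Summit.HodgeConjecture.HodgeConjecture.Cruxes.H413.K2E1AnalyticLevelSetNullU (frequently_line_nhdsWithin)

namespace Summit.HodgeConjecture.HodgeConjecture.Cruxes.H413.K2E1ChiConvDataLevelCMThree

variable (L : Type) [Field L] [NumberField L] [IsCMField L]
  [MeasurableSpace (quasiSplit (↥(maximalRealSubfield L)) L (IsCMField.complexConj L) 3).Adelic] [BorelSpace (quasiSplit (↥(maximalRealSubfield L)) L (IsCMField.complexConj L) 3).Adelic]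
  [MeasurableSpace (arch (↥(maximalRealSubfield L)) L (IsCMField.complexConj L) 3 ((StdForm.antidiagonal 3).over L))] [BorelSpace (arch (↥(maximalRealSubfield L)) L (IsCMField.complexConj L) 3 ((StdForm.antidiagonal 3).over L))]
  [MeasurableSpace (finAdelic (↥(maximalRealSubfield L)) L (IsCMField.complexConj L) 3 ((StdForm.antidiagonal 3).over L))] [BorelSpace (finAdelic (↥(maximalRealSubfield L)) L (IsCMField.complexConj L) 3 ((StdForm.antidiagonal 3).over L))]

/-- **THE (χ,τ) BALL DATA AT A GENERAL LEVEL, LETTERS GONE** (N = 3 twin of ★ `exists_chi_convData_level_cm_two`; general-level sibling of 📤 `exists_convData_maximalLevel_cm_three`): ★ `exists_chi_convData_cm_three` at `V := chiSectionSpace χ K′ ω`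
with `hfam := hfam_gauge_cm_three`, `hnc := hnc_gauge_cm_three`.  Conclusion VERBATIM ★ convData_χ's (with `V` instantiated). [cite: BernsteinLapid2019, §4 Claim 1] [cite: Bump1997, proof of Lemma 2.3.2] -/
theorem exists_chi_convData_level_cm_three
    (μ : Measure (quasiSplit (↥(maximalRealSubfield L)) L (IsCMField.complexConj L) 3).automorphicQuotient)
    [(quasiSplit (↥(maximalRealSubfield L)) L (IsCMField.complexConj L) 3).IsAutomorphicMeasure μ]
    (νG : Measure (quasiSplit (↥(maximalRealSubfield L)) L (IsCMField.complexConj L) 3).Adelic) [νG.IsHaarMeasure] [νG.IsInvInvariant] [SFinite νG]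
    {β : (quasiSplit (↥(maximalRealSubfield L)) L (IsCMField.complexConj L) 3).Adelic → ℝ≥0∞}
    (hβ : IsCoveringWeight ↥((arithmeticBorel (↥(maximalRealSubfield L)) L (IsCMField.complexConj L) 3).map
      (quasiSplit (↥(maximalRealSubfield L)) L (IsCMField.complexConj L) 3).arithmeticSubgroup.subtype) β)
    {μZ : Measure (borelQuotient (↥(maximalRealSubfield L)) L (IsCMField.complexConj L) 3)} [SFinite μZ]
    (hμZ : ∀ f : borelQuotient (↥(maximalRealSubfield L)) L (IsCMField.complexConj L) 3 → ℝ≥0∞, Measurable f →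
      ∫⁻ z, f z ∂μZ = ∫⁻ g, β g * f (toBorelQuotient (↥(maximalRealSubfield L)) L (IsCMField.complexConj L) 3 g) ∂νG)
    -- auxiliary Haar measures on `G_∞` (two-sided) and `G(𝔸_f)` (they only enter the proof of the letters)
    (μa : Measure (arch (↥(maximalRealSubfield L)) L (IsCMField.complexConj L) 3 ((StdForm.antidiagonal 3).over L))) [μa.IsHaarMeasure] [μa.IsMulRightInvariant]
    (μf : Measure (finAdelic (↥(maximalRealSubfield L)) L (IsCMField.complexConj L) 3 ((StdForm.antidiagonal 3).over L))) [μf.IsHaarMeasure]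
    -- the section space `V(χ, K′, ω)` and its structural binders
    {χ : HeckeCharacter L} {K' : Subgroup (quasiSplit (↥(maximalRealSubfield L)) L (IsCMField.complexConj L) 3).Adelic} {ω : ↥K' → ℂ}
    (hK' : K' ≤ ((standardMaximalCompactGL 3 L).comap (adelicVal (↥(maximalRealSubfield L)) L (IsCMField.complexConj L) 3 ((StdForm.antidiagonal 3).over L)) : Subgroup (quasiSplit (↥(maximalRealSubfield L)) L (IsCMField.complexConj L) 3).Adelic))
    (hKinf : ∀ k : arch (↥(maximalRealSubfield L)) L (IsCMField.complexConj L) 3 ((StdForm.antidiagonal 3).over L), adelicVal (↥(maximalRealSubfield L)) L (IsCMField.complexConj L) 3 ((StdForm.antidiagonal 3).over L) (archToAdelic (↥(maximalRealSubfield L)) L (IsCMField.complexConj L) 3 _ k) ∈ standardMaximalCompactGL 3 L →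
      archToAdelic (↥(maximalRealSubfield L)) L (IsCMField.complexConj L) 3 _ k ∈ K')
    (U₀ : Subgroup (GL (Fin 3) (FiniteAdeleRing (𝓞 L) L))) (hU₀o : IsOpen (U₀ : Set (GL (Fin 3) (FiniteAdeleRing (𝓞 L) L)))) (hU₀c : IsCompact (U₀ : Set (GL (Fin 3) (FiniteAdeleRing (𝓞 L) L))))
    (hU : ∀ b : finAdelic (↥(maximalRealSubfield L)) L (IsCMField.complexConj L) 3 ((StdForm.antidiagonal 3).over L), (b : GL (Fin 3) (FiniteAdeleRing (𝓞 L) L)) ∈ U₀ →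
      ∃ hb : finAdelicToAdelic (↥(maximalRealSubfield L)) L (IsCMField.complexConj L) 3 ((StdForm.antidiagonal 3).over L) b ∈ K', ω ⟨_, hb⟩ = 1)
    (hVc : ∀ φ ∈ chiSectionSpace χ K' ω, Continuous φ)
    (n : ℕ) :
    ∃ (a : ℝ≥0) (ha : 0 < a) (I : Type) (_ : Fintype I) (i₀ : I) (η : I → GL (Fin 3) (AdeleRing (𝓞 L) L) → ℝ) (κ : I → ℝ≥0)
      (T : I → HX (↥(maximalRealSubfield L)) L (IsCMField.complexConj L) 3 (n + 4) μ →L[ℂ] HX (↥(maximalRealSubfield L)) L (IsCMField.complexConj L) 3 (n + 4) μ) (ŝ : I → ℂ → ℂ),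
      -- the test functions `η_i` (smooth, non-negative, symmetric) and the self-convolutions `h_i = S_{η_i} η_i` (continuous, compactly supported, symmetric, real, `Re ≥ 0`)
      (∀ i, IsTestFunctionGL 3 L (η i) ∧ (∀ g, 0 ≤ η i g) ∧ (∀ g, η i g⁻¹ = η i g)) ∧
      (∀ i, Continuous (fun y : (quasiSplit (↥(maximalRealSubfield L)) L (IsCMField.complexConj L) 3).Adelic => orbitalSmoothing νG (fun x : (quasiSplit (↥(maximalRealSubfield L)) L (IsCMField.complexConj L) 3).Adelic => ((η i (adelicVal (↥(maximalRealSubfield L)) L (IsCMField.complexConj L) 3 ((StdForm.antidiagonal 3).over L) x) : ℝ) : ℂ)) (fun x : (quasiSplit (↥(maximalRealSubfield L)) L (IsCMField.complexConj L) 3).Adelic => ((η i (adelicVal (↥(maximalRealSubfield L)) L (IsCMField.complexConj L) 3 ((StdForm.antidiagonal 3).over L) x) : ℝ) : ℂ)) y) ∧ HasCompactSupport (fun y : (quasiSplit (↥(maximalRealSubfield L)) L (IsCMField.complexConj L) 3).Adelic => orbitalSmoothing νG (fun x : (quasiSplit (↥(maximalRealSubfield L)) L (IsCMField.complexConj L)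 3).Adelic => ((η i (adelicVal (↥(maximalRealSubfield L)) L (IsCMField.complexConj L) 3 ((StdForm.antidiagonal 3).over L) x) : ℝ) : ℂ)) (fun x : (quasiSplit (↥(maximalRealSubfield L)) L (IsCMField.complexConj L) 3).Adelic => ((η i (adelicVal (↥(maximalRealSubfield L)) L (IsCMField.complexConj L) 3 ((StdForm.antidiagonal 3).over L) x) : ℝ) : ℂ)) y) ∧
        (∀ g, (fun y : (quasiSplit (↥(maximalRealSubfield L)) L (IsCMField.complexConj L) 3).Adelic => orbitalSmoothing νG (fun x : (quasiSplit (↥(maximalRealSubfield L)) L (IsCMField.complexConj L) 3).Adelic => ((η i (adelicVal (↥(maximalRealSubfield L)) L (IsCMField.complexConj L) 3 ((StdForm.antidiagonal 3).over L) x) : ℝ) : ℂ)) (fun x : (quasiSplit (↥(maximalRealSubfield L)) L (IsCMField.complexConj L) 3).Adelic => ((η i (adelicVal (↥(maximalRealSubfield L)) L (IsCMField.complexConj L) 3 ((StdForm.antidiagonal 3).over L) x) : ℝ) : ℂ)) y) g⁻¹ = (fun y : (quasiSplit (↥(maximalRealSubfield L)) L (IsCMField.complexConj L) 3).Adelic =>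 orbitalSmoothing νG (fun x : (quasiSplit (↥(maximalRealSubfield L)) L (IsCMField.complexConj L) 3).Adelic => ((η i (adelicVal (↥(maximalRealSubfield L)) L (IsCMField.complexConj L) 3 ((StdForm.antidiagonal 3).over L) x) : ℝ) : ℂ)) (fun x : (quasiSplit (↥(maximalRealSubfield L)) L (IsCMField.complexConj L) 3).Adelic => ((η i (adelicVal (↥(maximalRealSubfield L)) L (IsCMField.complexConj L) 3 ((StdForm.antidiagonal 3).over L) x) : ℝ) : ℂ)) y) g) ∧ (∀ g, conj ((fun y : (quasiSplit (↥(maximalRealSubfield L)) L (IsCMField.complexConj L) 3).Adelic => orbitalSmoothing νG (fun x : (quasiSplit (↥(maximalRealSubfield L)) L (IsCMField.complexConj L) 3).Adelic => ((η i (adelicVal (↥(maximalRealSubfield L)) L (IsCMField.complexConj L) 3 ((StdForm.antidiagonal 3).over L) x) : ℝ) : ℂ)) (fun x : (quasiSplit (↥(maximalRealSubfield L)) L (IsCMField.complexConj L) 3).Adelic => ((η i (adelicVal (↥(maximalRealSubfield L)) L (IsCMField.complexConj L) 3 ((StdForm.antidiagonal 3).over L) x) : ℝ) : ℂ)) y)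 g) = (fun y : (quasiSplit (↥(maximalRealSubfield L)) L (IsCMField.complexConj L) 3).Adelic => orbitalSmoothing νG (fun x : (quasiSplit (↥(maximalRealSubfield L)) L (IsCMField.complexConj L) 3).Adelic => ((η i (adelicVal (↥(maximalRealSubfield L)) L (IsCMField.complexConj L) 3 ((StdForm.antidiagonal 3).over L) x) : ℝ) : ℂ)) (fun x : (quasiSplit (↥(maximalRealSubfield L)) L (IsCMField.complexConj L) 3).Adelic => ((η i (adelicVal (↥(maximalRealSubfield L)) L (IsCMField.complexConj L) 3 ((StdForm.antidiagonal 3).over L) x) : ℝ) : ℂ)) y) g) ∧ (∀ g, 0 ≤ ((fun y : (quasiSplit (↥(maximalRealSubfield L)) L (IsCMField.complexConj L) 3).Adelic => orbitalSmoothing νG (fun x : (quasiSplit (↥(maximalRealSubfield L)) L (IsCMField.complexConj L) 3).Adelic => ((η i (adelicVal (↥(maximalRealSubfield L)) L (IsCMField.complexConj L) 3 ((StdForm.antidiagonal 3).over L) x) : ℝ) : ℂ)) (fun x : (quasiSplit (↥(maximalRealSubfield L)) L (IsCMField.complexConj L) 3).Adelic => ((η i (adelicVal (↥(maximalRealSubfield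 L)) L (IsCMField.complexConj L) 3 ((StdForm.antidiagonal 3).over L) x) : ℝ) : ℂ)) y) g).re)) ∧
      -- the EIGENVALUE FUNCTIONS `ŝ_i` (entire), the scalar action of `h_i` on `V ⊗ H^z`, the cover of the ball, and the non-constant member `i₀`
      (∀ i, Differentiable ℂ (ŝ i)) ∧
      (∀ i, ∀ z : ℂ, ∀ φ ∈ chiSectionSpace χ K' ω, ∀ x : (quasiSplit (↥(maximalRealSubfield L)) L (IsCMField.complexConj L) 3).Adelic, (∫ y, (fun y : (quasiSplit (↥(maximalRealSubfield L)) L (IsCMField.complexConj L) 3).Adelic => orbitalSmoothing νG (fun x : (quasiSplit (↥(maximalRealSubfield L)) L (IsCMField.complexConj L) 3).Adelic => ((η i (adelicVal (↥(maximalRealSubfield L)) L (IsCMField.complexConj L) 3 ((StdForm.antidiagonal 3).over L) x) : ℝ) : ℂ)) (fun x : (quasiSplit (↥(maximalRealSubfield L)) L (IsCMField.complexConj L) 3).Adelic => ((η i (adelicVal (↥(maximalRealSubfield L)) L (IsCMField.complexConj L) 3 ((StdForm.antidiagonal 3).over L) x) : ℝ) : ℂ)) y) y * flatSectionU φ z (x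 * y) ∂νG) = ŝ i z * flatSectionU φ z x) ∧
      (∀ z ∈ Metric.ball (0 : ℂ) (n + 2), ∃ i, ŝ i z ≠ 0) ∧
      (∃ z₁ z₂ : ℂ, ŝ i₀ z₁ ≠ ŝ i₀ z₂) ∧ (∃ z ∈ Metric.ball (0 : ℂ) (n + 2), ŝ i₀ z ≠ 0) ∧
      (∀ i, 1 ≤ κ i ∧ a ≤ κ i * a) ∧
      (∀ i, ∀ z : borelQuotient (↥(maximalRealSubfield L)) L (IsCMField.complexConj L) 3, ∀ y ∈ tsupport (fun y : (quasiSplit (↥(maximalRealSubfield L)) L (IsCMField.complexConj L) 3).Adelic => orbitalSmoothing νG (fun x : (quasiSplit (↥(maximalRealSubfield L)) L (IsCMField.complexConj L) 3).Adelic => ((η i (adelicVal (↥(maximalRealSubfield L)) L (IsCMField.complexConj L) 3 ((StdForm.antidiagonal 3).over L) x) : ℝ) : ℂ)) (fun x : (quasiSplit (↥(maximalRealSubfield L)) L (IsCMField.complexConj L) 3).Adelic => ((η i (adelicVal (↥(maximalRealSubfield L)) L (IsCMField.complexConj L) 3 ((StdForm.antidiagonal 3).over L) x) : ℝ) : ℂ))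 y), borelQuotHeight (↥(maximalRealSubfield L)) L (IsCMField.complexConj L) 3 z ≤ κ i * borelQuotHeight (↥(maximalRealSubfield L)) L (IsCMField.complexConj L) 3 (rightShift (↥(maximalRealSubfield L)) L (IsCMField.complexConj L) 3 y z)) ∧
      (∀ i, ∃ hpos : 0 < κ i * a, Function.Injective (iota (iotaBound_cm_three L μ νG hβ hμZ hpos (n + 4))) ∧
        IsClosed ((LinearMap.range (iota (iotaBound_cm_three L μ νG hβ hμZ hpos (n + 4))).toLinearMap :
          Submodule ℂ (HN (↥(maximalRealSubfield L)) L (IsCMField.complexConj L) 3 (n + 4) (κ i * a) μZ)) : Set (HN (↥(maximalRealSubfield L)) L (IsCMField.complexConj L) 3 (n + 4) (κ i * a) μZ))) ∧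
      μZ {z | a < borelQuotHeight (↥(maximalRealSubfield L)) L (IsCMField.complexConj L) 3 z} ≠ 0 ∧
      (∀ i, ∀ u : HX (↥(maximalRealSubfield L)) L (IsCMField.complexConj L) 3 (n + 4) μ,
        (T i u : (quasiSplit (↥(maximalRealSubfield L)) L (IsCMField.complexConj L) 3).automorphicQuotient → ℂ) =ᵐ[μ.withDensity fun x =>
            (((supHeight (↥(maximalRealSubfield L)) L (IsCMField.complexConj L) 3 x)⁻¹ ^ (2 * (n + 4)) : ℝ≥0) : ℝ≥0∞)]
          fun ξ => ∫ y, (fun y : (quasiSplit (↥(maximalRealSubfield L)) L (IsCMField.complexConj L) 3).Adelic => orbitalSmoothing νG (fun x : (quasiSplit (↥(maximalRealSubfield L)) L (IsCMField.complexConj L) 3).Adelic => ((η i (adelicVal (↥(maximalRealSubfield L)) L (IsCMField.complexConj L) 3 ((StdForm.antidiagonal 3).over L) x) : ℝ) : ℂ)) (fun x : (quasiSplit (↥(maximalRealSubfield L)) L (IsCMField.complexConj L) 3).Adelic => ((η i (adelicVal (↥(maximalRealSubfield L)) L (IsCMField.complexConj L) 3 ((StdForm.antidiagonal 3).over L) x)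 : ℝ) : ℂ)) y) y * (u : (quasiSplit (↥(maximalRealSubfield L)) L (IsCMField.complexConj L) 3).automorphicQuotient → ℂ) (y⁻¹ • ξ) ∂νG) ∧
      (∀ i, ∃ hs : ShiftBound (↥(maximalRealSubfield L)) L (IsCMField.complexConj L) 3 (n + 4) a (κ i * a) νG μZ (fun y : (quasiSplit (↥(maximalRealSubfield L)) L (IsCMField.complexConj L) 3).Adelic => orbitalSmoothing νG (fun x : (quasiSplit (↥(maximalRealSubfield L)) L (IsCMField.complexConj L) 3).Adelic => ((η i (adelicVal (↥(maximalRealSubfield L)) L (IsCMField.complexConj L) 3 ((StdForm.antidiagonal 3).over L) x) : ℝ) : ℂ)) (fun x : (quasiSplit (↥(maximalRealSubfield L)) L (IsCMField.complexConj L) 3).Adelic => ((η i (adelicVal (↥(maximalRealSubfield L)) L (IsCMField.complexConj L) 3 ((StdForm.antidiagonal 3).over L) x) : ℝ) : ℂ)) y),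
        ∀ (h01 : a ≤ κ i * a),
          deltaShift hs ∘L iota (iotaBound_cm_three L μ νG hβ hμZ ha (n + 4)) =
            restrHN (↥(maximalRealSubfield L)) L (IsCMField.complexConj L) 3 (n + 4) h01 μZ ∘L iota (iotaBound_cm_three L μ νG hβ hμZ ha (n + 4)) ∘L T i) :=
  exists_chi_convData_cm_three L μ νG hβ hμZ (chiSectionSpace χ K' ω) (hfam_gauge_cm_three L νG μa μf hK' hKinf U₀ hU₀o hU₀c hU hVc)
    (hnc_gauge_cm_three L νG μa μf hK' hKinf U₀ hU₀o hU₀c hU hVc) n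

/-! ## The same ball data WITH the functional-equation symmetry `ŝ_i(2 − z) = ŝ_i(z)` of its eigenvalues, for SELF-DUAL `χ` (twin of ★ CMTwo ED. 2) -/

/-- **THE (χ,τ) BALL DATA AT A GENERAL LEVEL, WITH `ŝ_i(2 − z) = ŝ_i(z)`** (self-dual `χ`; N = 3 centre `z = 1`): the conclusion of `exists_chi_convData_level_cm_three` AND the conjunct `∀ i z, ŝ i (2 − z) = ŝ i z`, exported
from inside the ∃-package (a consumer cannot add it after `obtain`).  Extra binders = ★ (C) FILE 2 `chi_symbol_hsymm_of_selfDual_cm_three_of_mem`'s: `hsd : χʷ = χ`, a Haar measure `ν` on `N(𝔸)` with a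
compact-closure fundamental domain, ONE measurable bounded section `φ₀ ∈ V(χ, K′, ω)` with a non-vanishing intertwining integral at a point of the `U(2,1)` Godement half-plane `Re w₁ > 2` (`hMne`).  Proof: the axis identity
`ŝ_i(1 − it) = ŝ_i(1 + it)` from ★ (its `hR` is the action clause of the package), then the identity principle for the entire `ŝ_i` and `ŝ_i ∘ (2 − ·)` along the line `Re z = 1`
(★ `frequently_line_nhdsWithin`, `AnalyticOnNhd.eqOn_of_preconnected_of_frequently_eq`). [cite: BernsteinLapid2019, §4 Claim 1] [cite: MoeglinWaldspurger1995, IV.1.10] -/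
theorem exists_chi_convData_level_cm_three_symm
    (μ : Measure (quasiSplit (↥(maximalRealSubfield L)) L (IsCMField.complexConj L) 3).automorphicQuotient)
    [(quasiSplit (↥(maximalRealSubfield L)) L (IsCMField.complexConj L) 3).IsAutomorphicMeasure μ]
    (νG : Measure (quasiSplit (↥(maximalRealSubfield L)) L (IsCMField.complexConj L) 3).Adelic) [νG.IsHaarMeasure] [νG.IsInvInvariant] [SFinite νG]
    {β : (quasiSplit (↥(maximalRealSubfield L)) L (IsCMField.complexConj L) 3).Adelic → ℝ≥0∞}
    (hβ : IsCoveringWeight ↥((arithmeticBorel (↥(maximalRealSubfield L)) L (IsCMField.complexConj L) 3).map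
      (quasiSplit (↥(maximalRealSubfield L)) L (IsCMField.complexConj L) 3).arithmeticSubgroup.subtype) β)
    {μZ : Measure (borelQuotient (↥(maximalRealSubfield L)) L (IsCMField.complexConj L) 3)} [SFinite μZ]
    (hμZ : ∀ f : borelQuotient (↥(maximalRealSubfield L)) L (IsCMField.complexConj L) 3 → ℝ≥0∞, Measurable f →
      ∫⁻ z, f z ∂μZ = ∫⁻ g, β g * f (toBorelQuotient (↥(maximalRealSubfield L)) L (IsCMField.complexConj L) 3 g) ∂νG)
    -- auxiliary Haar measures on `G_∞` (two-sided) and `G(𝔸_f)` (they only enter the proof of the letters)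
    (μa : Measure (arch (↥(maximalRealSubfield L)) L (IsCMField.complexConj L) 3 ((StdForm.antidiagonal 3).over L))) [μa.IsHaarMeasure] [μa.IsMulRightInvariant]
    (μf : Measure (finAdelic (↥(maximalRealSubfield L)) L (IsCMField.complexConj L) 3 ((StdForm.antidiagonal 3).over L))) [μf.IsHaarMeasure]
    -- the section space `V(χ, K′, ω)` and its structural binders
    {χ : HeckeCharacter L} {K' : Subgroup (quasiSplit (↥(maximalRealSubfield L)) L (IsCMField.complexConj L) 3).Adelic} {ω : ↥K' → ℂ}
    (hK' : K' ≤ ((standardMaximalCompactGL 3 L).comap (adelicVal (↥(maximalRealSubfield L)) L (IsCMField.complexConj L) 3 ((StdForm.antidiagonal 3).over L)) : Subgroup (quasiSplit (↥(maximalRealSubfield L)) L (IsCMField.complexConj L) 3).Adelic))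
    (hKinf : ∀ k : arch (↥(maximalRealSubfield L)) L (IsCMField.complexConj L) 3 ((StdForm.antidiagonal 3).over L), adelicVal (↥(maximalRealSubfield L)) L (IsCMField.complexConj L) 3 ((StdForm.antidiagonal 3).over L) (archToAdelic (↥(maximalRealSubfield L)) L (IsCMField.complexConj L) 3 _ k) ∈ standardMaximalCompactGL 3 L →
      archToAdelic (↥(maximalRealSubfield L)) L (IsCMField.complexConj L) 3 _ k ∈ K')
    (U₀ : Subgroup (GL (Fin 3) (FiniteAdeleRing (𝓞 L) L))) (hU₀o : IsOpen (U₀ : Set (GL (Fin 3) (FiniteAdeleRing (𝓞 L) L)))) (hU₀c : IsCompact (U₀ : Set (GL (Fin 3) (FiniteAdeleRing (𝓞 L) L))))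
    (hU : ∀ b : finAdelic (↥(maximalRealSubfield L)) L (IsCMField.complexConj L) 3 ((StdForm.antidiagonal 3).over L), (b : GL (Fin 3) (FiniteAdeleRing (𝓞 L) L)) ∈ U₀ →
      ∃ hb : finAdelicToAdelic (↥(maximalRealSubfield L)) L (IsCMField.complexConj L) 3 ((StdForm.antidiagonal 3).over L) b ∈ K', ω ⟨_, hb⟩ = 1)
    (hVc : ∀ φ ∈ chiSectionSpace χ K' ω, Continuous φ)
    -- self-duality data (★ `chi_symbol_hsymm_of_selfDual_cm_three_of_mem`'s binders)
    (ν : Measure ↥(adelicUnipotent (↥(maximalRealSubfield L)) L (IsCMField.complexConj L) 3)) [ν.IsHaarMeasure] [ν.IsInvInvariant]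
    {𝓕 : Set ↥(adelicUnipotent (↥(maximalRealSubfield L)) L (IsCMField.complexConj L) 3)}
    (h𝓕N : IsFundamentalDomain ↥(rationalUnipotent (↥(maximalRealSubfield L)) L (IsCMField.complexConj L) 3) 𝓕 ν) (h𝓕c : IsCompact (closure 𝓕))
    (hsd : reflectChar (IsCMField.complexConj L) χ = χ)
    {φ₀ : (quasiSplit (↥(maximalRealSubfield L)) L (IsCMField.complexConj L) 3).Adelic → ℂ} (hφ₀ : φ₀ ∈ chiSectionSpace χ K' ω) (hφ₀m : Measurable φ₀) {Cφ : ℝ} (hφ₀C : ∀ x, ‖φ₀ x‖ ≤ Cφ)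
    (hMne : ∃ (g : (quasiSplit (↥(maximalRealSubfield L)) L (IsCMField.complexConj L) 3).Adelic) (w₁ : ℂ), 2 < w₁.re ∧
      ∫ v : ↥(adelicUnipotent (↥(maximalRealSubfield L)) L (IsCMField.complexConj L) 3), flatSectionU φ₀ w₁
        ((quasiSplit (↥(maximalRealSubfield L)) L (IsCMField.complexConj L) 3).toAdelic
          (weylLongU ((IsCMField.complexConj L : L ≃ₐ[↥(maximalRealSubfield L)] L) : L →+* L) (rfl : (StdForm.antidiagonal 3).over L = (StdForm.antidiagonal 3).over L)) *
          ((v : (quasiSplit (↥(maximalRealSubfield L)) L (IsCMField.complexConj L) 3).Adelic) * g)) ∂ν ≠ 0)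
    (n : ℕ) :
    ∃ (a : ℝ≥0) (ha : 0 < a) (I : Type) (_ : Fintype I) (i₀ : I) (η : I → GL (Fin 3) (AdeleRing (𝓞 L) L) → ℝ) (κ : I → ℝ≥0)
      (T : I → HX (↥(maximalRealSubfield L)) L (IsCMField.complexConj L) 3 (n + 4) μ →L[ℂ] HX (↥(maximalRealSubfield L)) L (IsCMField.complexConj L) 3 (n + 4) μ) (ŝ : I → ℂ → ℂ),
      (∀ i (z : ℂ), ŝ i (2 - z) = ŝ i z) ∧
      -- the test functions `η_i` (smooth, non-negative, symmetric) and the self-convolutions `h_i = S_{η_i} η_i` (continuous, compactly supported, symmetric, real, `Re ≥ 0`)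
      (∀ i, IsTestFunctionGL 3 L (η i) ∧ (∀ g, 0 ≤ η i g) ∧ (∀ g, η i g⁻¹ = η i g)) ∧
      (∀ i, Continuous (fun y : (quasiSplit (↥(maximalRealSubfield L)) L (IsCMField.complexConj L) 3).Adelic => orbitalSmoothing νG (fun x : (quasiSplit (↥(maximalRealSubfield L)) L (IsCMField.complexConj L) 3).Adelic => ((η i (adelicVal (↥(maximalRealSubfield L)) L (IsCMField.complexConj L) 3 ((StdForm.antidiagonal 3).over L) x) : ℝ) : ℂ)) (fun x : (quasiSplit (↥(maximalRealSubfield L)) L (IsCMField.complexConj L) 3).Adelic => ((η i (adelicVal (↥(maximalRealSubfield L)) L (IsCMField.complexConj L) 3 ((StdForm.antidiagonal 3).over L) x) : ℝ) : ℂ)) y) ∧ HasCompactSupport (fun y : (quasiSplit (↥(maximalRealSubfield L)) L (IsCMField.complexConj L) 3).Adelic => orbitalSmoothing νG (fun x : (quasiSplit (↥(maximalRealSubfield L)) L (IsCMField.complexConj L) 3).Adelic => ((η i (adelicVal (↥(maximalRealSubfield L)) L (IsCMField.complexConj L) 3 ((StdForm.antidiagonal 3).over L) x) : ℝ) : ℂ))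 (fun x : (quasiSplit (↥(maximalRealSubfield L)) L (IsCMField.complexConj L) 3).Adelic => ((η i (adelicVal (↥(maximalRealSubfield L)) L (IsCMField.complexConj L) 3 ((StdForm.antidiagonal 3).over L) x) : ℝ) : ℂ)) y) ∧
        (∀ g, (fun y : (quasiSplit (↥(maximalRealSubfield L)) L (IsCMField.complexConj L) 3).Adelic => orbitalSmoothing νG (fun x : (quasiSplit (↥(maximalRealSubfield L)) L (IsCMField.complexConj L) 3).Adelic => ((η i (adelicVal (↥(maximalRealSubfield L)) L (IsCMField.complexConj L) 3 ((StdForm.antidiagonal 3).over L) x) : ℝ) : ℂ)) (fun x : (quasiSplit (↥(maximalRealSubfield L)) L (IsCMField.complexConj L) 3).Adelic => ((η i (adelicVal (↥(maximalRealSubfield L)) L (IsCMField.complexConj L) 3 ((StdForm.antidiagonal 3).over L) x) : ℝ) : ℂ)) y) g⁻¹ = (fun y : (quasiSplit (↥(maximalRealSubfield L)) L (IsCMField.complexConj L) 3).Adelic => orbitalSmoothing νG (fun x : (quasiSplit (↥(maximalRealSubfield L)) L (IsCMField.complexConj L) 3).Adelic => ((η i (adelicVal (↥(maximalRealSubfield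 L)) L (IsCMField.complexConj L) 3 ((StdForm.antidiagonal 3).over L) x) : ℝ) : ℂ)) (fun x : (quasiSplit (↥(maximalRealSubfield L)) L (IsCMField.complexConj L) 3).Adelic => ((η i (adelicVal (↥(maximalRealSubfield L)) L (IsCMField.complexConj L) 3 ((StdForm.antidiagonal 3).over L) x) : ℝ) : ℂ)) y) g) ∧ (∀ g, conj ((fun y : (quasiSplit (↥(maximalRealSubfield L)) L (IsCMField.complexConj L) 3).Adelic => orbitalSmoothing νG (fun x : (quasiSplit (↥(maximalRealSubfield L)) L (IsCMField.complexConj L) 3).Adelic => ((η i (adelicVal (↥(maximalRealSubfield L)) L (IsCMField.complexConj L) 3 ((StdForm.antidiagonal 3).over L) x) : ℝ) : ℂ)) (fun x : (quasiSplit (↥(maximalRealSubfield L)) L (IsCMField.complexConj L) 3).Adelic => ((η i (adelicVal (↥(maximalRealSubfield L)) L (IsCMField.complexConj L) 3 ((StdForm.antidiagonal 3).over L) x) : ℝ) : ℂ)) y) g) = (fun y : (quasiSplit (↥(maximalRealSubfield L)) L (IsCMField.complexConj L) 3).Adelic => orbitalSmoothing νG (fun x : (quasiSplit (↥(maximalRealSubfield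 L)) L (IsCMField.complexConj L) 3).Adelic => ((η i (adelicVal (↥(maximalRealSubfield L)) L (IsCMField.complexConj L) 3 ((StdForm.antidiagonal 3).over L) x) : ℝ) : ℂ)) (fun x : (quasiSplit (↥(maximalRealSubfield L)) L (IsCMField.complexConj L) 3).Adelic => ((η i (adelicVal (↥(maximalRealSubfield L)) L (IsCMField.complexConj L) 3 ((StdForm.antidiagonal 3).over L) x) : ℝ) : ℂ)) y) g) ∧ (∀ g, 0 ≤ ((fun y : (quasiSplit (↥(maximalRealSubfield L)) L (IsCMField.complexConj L) 3).Adelic => orbitalSmoothing νG (fun x : (quasiSplit (↥(maximalRealSubfield L)) L (IsCMField.complexConj L) 3).Adelic => ((η i (adelicVal (↥(maximalRealSubfield L)) L (IsCMField.complexConj L) 3 ((StdForm.antidiagonal 3).over L) x) : ℝ) : ℂ)) (fun x : (quasiSplit (↥(maximalRealSubfield L)) L (IsCMField.complexConj L) 3).Adelic => ((η i (adelicVal (↥(maximalRealSubfield L)) L (IsCMField.complexConj L) 3 ((StdForm.antidiagonal 3).over L) x) : ℝ) : ℂ)) y) g).re)) ∧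
      -- the EIGENVALUE FUNCTIONS `ŝ_i` (entire), the scalar action of `h_i` on `V ⊗ H^z`, the cover of the ball, and the non-constant member `i₀`
      (∀ i, Differentiable ℂ (ŝ i)) ∧
      (∀ i, ∀ z : ℂ, ∀ φ ∈ chiSectionSpace χ K' ω, ∀ x : (quasiSplit (↥(maximalRealSubfield L)) L (IsCMField.complexConj L) 3).Adelic, (∫ y, (fun y : (quasiSplit (↥(maximalRealSubfield L)) L (IsCMField.complexConj L) 3).Adelic => orbitalSmoothing νG (fun x : (quasiSplit (↥(maximalRealSubfield L)) L (IsCMField.complexConj L) 3).Adelic => ((η i (adelicVal (↥(maximalRealSubfield L)) L (IsCMField.complexConj L) 3 ((StdForm.antidiagonal 3).over L) x) : ℝ) : ℂ)) (fun x : (quasiSplit (↥(maximalRealSubfield L)) L (IsCMField.complexConj L) 3).Adelic => ((η i (adelicVal (↥(maximalRealSubfield L)) L (IsCMField.complexConj L) 3 ((StdForm.antidiagonal 3).over L) x) : ℝ) : ℂ)) y) y * flatSectionU φ z (x * y) ∂νG) = ŝ i z * flatSectionU φ z x) ∧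
      (∀ z ∈ Metric.ball (0 : ℂ) (n + 2), ∃ i, ŝ i z ≠ 0) ∧
      (∃ z₁ z₂ : ℂ, ŝ i₀ z₁ ≠ ŝ i₀ z₂) ∧ (∃ z ∈ Metric.ball (0 : ℂ) (n + 2), ŝ i₀ z ≠ 0) ∧
      (∀ i, 1 ≤ κ i ∧ a ≤ κ i * a) ∧
      (∀ i, ∀ z : borelQuotient (↥(maximalRealSubfield L)) L (IsCMField.complexConj L) 3, ∀ y ∈ tsupport (fun y : (quasiSplit (↥(maximalRealSubfield L)) L (IsCMField.complexConj L) 3).Adelic => orbitalSmoothing νG (fun x : (quasiSplit (↥(maximalRealSubfield L)) L (IsCMField.complexConj L) 3).Adelic => ((η i (adelicVal (↥(maximalRealSubfield L)) L (IsCMField.complexConj L) 3 ((StdForm.antidiagonal 3).over L) x) : ℝ) : ℂ)) (fun x : (quasiSplit (↥(maximalRealSubfield L)) L (IsCMField.complexConj L) 3).Adelic => ((η i (adelicVal (↥(maximalRealSubfield L)) L (IsCMField.complexConj L) 3 ((StdForm.antidiagonal 3).over L) x) : ℝ) : ℂ)) y), borelQuotHeight (↥(maximalRealSubfield L)) L (IsCMField.complexConj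 L) 3 z ≤ κ i * borelQuotHeight (↥(maximalRealSubfield L)) L (IsCMField.complexConj L) 3 (rightShift (↥(maximalRealSubfield L)) L (IsCMField.complexConj L) 3 y z)) ∧
      (∀ i, ∃ hpos : 0 < κ i * a, Function.Injective (iota (iotaBound_cm_three L μ νG hβ hμZ hpos (n + 4))) ∧
        IsClosed ((LinearMap.range (iota (iotaBound_cm_three L μ νG hβ hμZ hpos (n + 4))).toLinearMap :
          Submodule ℂ (HN (↥(maximalRealSubfield L)) L (IsCMField.complexConj L) 3 (n + 4) (κ i * a) μZ)) : Set (HN (↥(maximalRealSubfield L)) L (IsCMField.complexConj L) 3 (n + 4) (κ i * a) μZ))) ∧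
      μZ {z | a < borelQuotHeight (↥(maximalRealSubfield L)) L (IsCMField.complexConj L) 3 z} ≠ 0 ∧
      (∀ i, ∀ u : HX (↥(maximalRealSubfield L)) L (IsCMField.complexConj L) 3 (n + 4) μ,
        (T i u : (quasiSplit (↥(maximalRealSubfield L)) L (IsCMField.complexConj L) 3).automorphicQuotient → ℂ) =ᵐ[μ.withDensity fun x =>
            (((supHeight (↥(maximalRealSubfield L)) L (IsCMField.complexConj L) 3 x)⁻¹ ^ (2 * (n + 4)) : ℝ≥0) : ℝ≥0∞)]
          fun ξ => ∫ y, (fun y : (quasiSplit (↥(maximalRealSubfield L)) L (IsCMField.complexConj L) 3).Adelic => orbitalSmoothing νG (fun x : (quasiSplit (↥(maximalRealSubfield L)) L (IsCMField.complexConj L) 3).Adelic => ((η i (adelicVal (↥(maximalRealSubfield L)) L (IsCMField.complexConj L) 3 ((StdForm.antidiagonal 3).over L) x) : ℝ) : ℂ)) (fun x : (quasiSplit (↥(maximalRealSubfield L)) L (IsCMField.complexConj L) 3).Adelic => ((η i (adelicVal (↥(maximalRealSubfield L)) L (IsCMField.complexConj L) 3 ((StdForm.antidiagonal 3).over L) x)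 : ℝ) : ℂ)) y) y * (u : (quasiSplit (↥(maximalRealSubfield L)) L (IsCMField.complexConj L) 3).automorphicQuotient → ℂ) (y⁻¹ • ξ) ∂νG) ∧
      (∀ i, ∃ hs : ShiftBound (↥(maximalRealSubfield L)) L (IsCMField.complexConj L) 3 (n + 4) a (κ i * a) νG μZ (fun y : (quasiSplit (↥(maximalRealSubfield L)) L (IsCMField.complexConj L) 3).Adelic => orbitalSmoothing νG (fun x : (quasiSplit (↥(maximalRealSubfield L)) L (IsCMField.complexConj L) 3).Adelic => ((η i (adelicVal (↥(maximalRealSubfield L)) L (IsCMField.complexConj L) 3 ((StdForm.antidiagonal 3).over L) x) : ℝ) : ℂ)) (fun x : (quasiSplit (↥(maximalRealSubfield L)) L (IsCMField.complexConj L) 3).Adelic => ((η i (adelicVal (↥(maximalRealSubfield L)) L (IsCMField.complexConj L) 3 ((StdForm.antidiagonal 3).over L) x) : ℝ) : ℂ)) y),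
        ∀ (h01 : a ≤ κ i * a),
          deltaShift hs ∘L iota (iotaBound_cm_three L μ νG hβ hμZ ha (n + 4)) =
            restrHN (↥(maximalRealSubfield L)) L (IsCMField.complexConj L) 3 (n + 4) h01 μZ ∘L iota (iotaBound_cm_three L μ νG hβ hμZ ha (n + 4)) ∘L T i)  := by
  obtain ⟨a, ha, I, hI, i₀, η, κ, T, ŝ, hη, hconv, hŝd, hact, hcov, hnc, hne0, hκ, hcmp, hι, hμZne, hT, hpack⟩ :=
    exists_chi_convData_level_cm_three L μ νG hβ hμZ μa μf hK' hKinf U₀ hU₀o hU₀c hU hVc n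
  refine ⟨a, ha, I, hI, i₀, η, κ, T, ŝ, fun i => ?_, hη, hconv, hŝd, hact, hcov, hnc, hne0, hκ, hcmp, hι, hμZne, hT, hpack⟩
  -- the axis identity from ★ (C) FILE 2 (self-dual χ, centre 1)
  have haxis : ∀ t : ℝ, ŝ i (1 - t * Complex.I) = ŝ i (1 + t * Complex.I) := fun t =>
    chi_symbol_hsymm_of_selfDual_cm_three_of_mem L νG ν h𝓕N h𝓕c hsd hK' hφ₀ hφ₀m hφ₀C (hconv i).1 (hconv i).2.1 (ŝ i) (hŝd i) (fun z ψ hψ x => hact i z ψ hψ x) hMne t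
  -- identity principle: `z ↦ ŝ i (2 - z)` and `ŝ i` are entire and agree along the line `Re z = 1` near `1`
  have h1 : AnalyticOnNhd ℂ (fun z => ŝ i (2 - z)) univ :=
    Complex.analyticOnNhd_univ_iff_differentiable.2 ((hŝd i).comp (differentiable_const _ |>.sub differentiable_id))
  have h2 : AnalyticOnNhd ℂ (ŝ i) univ := Complex.analyticOnNhd_univ_iff_differentiable.2 (hŝd i)
  have hfreq : ∃ᶠ z in 𝓝[≠] ((1 : ℂ)), (fun z => ŝ i (2 - z)) z = ŝ i z := by
    refine frequently_line_nhdsWithin (1 : ℂ) Complex.I Complex.I_ne_zero (p := fun z => (fun z => ŝ i (2 - z)) z = ŝ i z) fun t _ => ?_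
    show ŝ i (2 - (1 + (t : ℂ) * Complex.I)) = ŝ i (1 + (t : ℂ) * Complex.I)
    rw [show (2 : ℂ) - (1 + (t : ℂ) * Complex.I) = 1 - (t : ℂ) * Complex.I by ring]
    exact haxis t
  have heq := h1.eqOn_of_preconnected_of_frequently_eq h2 isPreconnected_univ (mem_univ _) hfreq
  exact fun z => heq (mem_univ z)

end Summit.HodgeConjecture.HodgeConjecture.Cruxes.H413.K2E1ChiConvDataLevelCMThree

end
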